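import Mathlib.Combinatorics.Additive.Energy
import Mathlib.Algebra.Group.Pointwise.Finset.Basic
import Mathlib.Analysis.SpecialFunctions.Pow.Real
import HarnessLib

/-!
# The Balog–Szemerédi–Gowers theorem (Tao–Vu, Theorem 2.29), the energy-to-partial-sumset lemma (Lemma 2.30) and the energy form (Zhao, Theorem 7.13.6)

Topic `Literature/Combinatorics/Additive`. Named facts (D-0014: statements as printed, no proofs) from
T. Tao, V. Vu, *Additive Combinatorics*, CUP 2006, §2.5:

* `balogSzemerediGowers` — **Theorem 2.29** (Balog–Szemerédi–Gowers, the Sudakov–Szemerédi–Vu form):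
  if `A, B` are additive sets (finite, nonempty subsets of an abelian group), `G ⊆ A × B`,
  `|G| ≥ |A||B|/K` and the partial sumset `A +_G B = {a + b : (a, b) ∈ G}` has
  `|A +_G B| ≤ K' |A|^{1/2} |B|^{1/2}` (`K ≥ 1`, `K' > 0`), then there are `A' ⊆ A`, `B' ⊆ B` with
  `|A'| ≥ |A| / (4 √2 K)`, `|B'| ≥ |B| / (4K)` and `|A' + B'| ≤ 2^{12} K^5 (K')^3 |A|^{1/2} |B|^{1/2}`.
* `energy_partialSumset` — **Lemma 2.30** (second half): if `E(A, B) ≥ |A|^{3/2} |B|^{3/2} / K`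
  (`K ≥ 1`) then some `G ⊆ A × B` has `|G| ≥ |A||B| / (2K)` and `|A +_G B| ≤ 2K |A|^{1/2}|B|^{1/2}`
  (elementary — Cauchy–Schwarz and a threshold selection — but vendored so that the two facts compose
  to the usual "large energy ⇒ large pair with small sumset" corollary with explicit constants:
  `|A'| ≥ |A|/(8√2 K)`, `|B'| ≥ |B|/(8K)`, `|A' + B'| ≤ 2^{20} K^8 |A|^{1/2}|B|^{1/2}`).

* `Zhao2023_thm7136` — the single-subset **energy form** (Y. Zhao, *Graph Theory and Additive
  Combinatorics*, CUP 2023, Theorem 7.13.6; Balog–Szemerédi 1994, Gowers 2001): `E(A) ≥ |A|³/K` ⇒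
  some `A' ⊆ A` has `|A'| ≥ K^{-O(1)}|A|` and `|A' + A'| ≤ K^{O(1)}|A'|` — Zhao derives it from the
  two-set form via the Ruzsa triangle inequality. `K^{±O(1)}` is read as `C·K^{C}` with ONE absolute
  constant `C` (Zhao's proof — popular sums `≥ n/2K`, paths of length 3 — produces absolute factors as
  well as powers of `K`; for `K ≥ 2` they are absorbed in the exponent, but near `K = 1` a literal pure
  power would assert near-total structure that the printed proof does not give). This is, symbol for
  symbol up to `⌈C⌉`, the second inline hypothesis of `AreaUncertainty.BoundedAreaCore`.

Additive energy is Mathlib's `Finset.addEnergy A B = #{(a₁,b₁,a₂,b₂) : a₁ + b₁ = a₂ + b₂}` = Tao–Vu's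
`E(A, B)` (Def. 2.8). Grounds `Summit.QuantumAdvantage.QuantumAdvantage.Theses.AreaUncertainty.BoundedAreaCore`,
whose second hypothesis ("`E(A) ≥ |A|³/K ⇒ A' ⊆ A`, `|A'| ≥ |A|/(C₁K^{C₁})`, `|A' + A'| ≤ C₁K^{C₁}|A'|`")
follows from these two facts with `A = B` plus the Plünnecke–Ruzsa inequality (Mathlib
`Mathlib/Combinatorics/Additive/PluenneckeRuzsa.lean`) to pass from `|A' + B'|` to `|A' + A'|`.

Deliberately NOT here: the equivalences of Theorem 2.31, the asymmetric version (Thm 2.35), the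
non-commutative version (Thm 2.44), the graph-theoretic proof (§6.4).
-/

namespace Literature.Combinatorics.Additive

open Finset
open scoped Pointwise

/-- The partial sumset `A +_G B := {a + b : (a, b) ∈ G}` along `G ⊆ A × B`.
[cite: TaoVu2006, §2.5 (partial sum set)] -/
def partialSumset {Z : Type*} [Add Z] [DecidableEq Z] (G : Finset (Z × Z)) : Finset Z :=
  G.image fun p => p.1 + p.2

/-- **Balog–Szemerédi–Gowers theorem** (Tao–Vu, Theorem 2.29, as printed): let `A, B` be finite
nonempty subsets of an abelian group and `G ⊆ A × B` with `|G| ≥ |A||B|/K` and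
`|A +_G B| ≤ K' |A|^{1/2}|B|^{1/2}` for some `K ≥ 1`, `K' > 0`. Then there exist `A' ⊆ A`, `B' ⊆ B`
with `|A'| ≥ |A|/(4√2 K)` (2.18), `|B'| ≥ |B|/(4K)` (2.19) and
`|A' + B'| ≤ 2^{12} K^5 (K')^3 |A|^{1/2}|B|^{1/2}` (2.20).
[cite: TaoVu2006, Theorem 2.29] -/
def balogSzemerediGowers : Prop :=
  ∀ (Z : Type) [AddCommGroup Z] [DecidableEq Z] (A B : Finset Z) (G : Finset (Z × Z)) (K K' : ℝ),
    A.Nonempty → B.Nonempty → 1 ≤ K → 0 < K' → G ⊆ A ×ˢ B →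
    (A.card : ℝ) * B.card / K ≤ G.card →
    ((partialSumset G).card : ℝ) ≤ K' * Real.sqrt (A.card * B.card) →
    ∃ A' ⊆ A, ∃ B' ⊆ B,
      (A.card : ℝ) / (4 * Real.sqrt 2 * K) ≤ A'.card ∧ (B.card : ℝ) / (4 * K) ≤ B'.card ∧
      ((A' + B').card : ℝ) ≤ 2 ^ 12 * K ^ 5 * K' ^ 3 * Real.sqrt (A.card * B.card)

/-- **Large energy gives a dense partial sumset graph** (Tao–Vu, Lemma 2.30, second assertion, as
printed): if `A, B` are finite nonempty subsets of an abelian group with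
`E(A, B) ≥ |A|^{3/2}|B|^{3/2}/K` for some `K ≥ 1`, then there is `G ⊆ A × B` with
`|G| ≥ |A||B|/(2K)` and `|A +_G B| ≤ 2K |A|^{1/2}|B|^{1/2}` (and similarly for partial difference
sets). `E(A,B)` is Mathlib's `Finset.addEnergy`. [cite: TaoVu2006, Lemma 2.30] -/
def energy_partialSumset : Prop :=
  ∀ (Z : Type) [AddCommGroup Z] [DecidableEq Z] (A B : Finset Z) (K : ℝ),
    A.Nonempty → B.Nonempty → 1 ≤ K →
    Real.sqrt ((A.card : ℝ) * B.card) ^ 3 / K ≤ Finset.addEnergy A B →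
    ∃ G : Finset (Z × Z), G ⊆ A ×ˢ B ∧ (A.card : ℝ) * B.card / (2 * K) ≤ G.card ∧
      ((partialSumset G).card : ℝ) ≤ 2 * K * Real.sqrt (A.card * B.card)

/-- **Balog–Szemerédi–Gowers theorem, additive-energy / single-subset form** (Zhao 2023,
Theorem 7.13.6, as printed): let `A` be a finite subset of an abelian group with `E(A) ≥ |A|³/K`.
Then there is a subset `A' ⊆ A` with `|A'| ≥ K^{-O(1)}|A|` and `|A' + A'| ≤ K^{O(1)}|A'|`.
Recorded with one absolute constant `C > 0` bounding both implied constants, factors included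
(`|A| ≤ C K^C |A'|`, `|A' + A'| ≤ C K^C |A'|`; see the module docstring), for non-empty `A` and
`K ≥ 1`; `E(A) = Finset.addEnergy A A`, and `A' + A'` is the pointwise sumset
(`Finset.image_add_product` rewrites the `(A' ×ˢ A').image (·.1 + ·.2)` spelling into it).
[cite: Zhao2023, Theorem 7.13.6] -/
def Zhao2023_thm7136 : Prop :=
  ∃ C : ℝ, 0 < C ∧
    ∀ (Z : Type) [AddCommGroup Z] [DecidableEq Z] (A : Finset Z) (K : ℝ), A.Nonempty → 1 ≤ K →
      (A.card : ℝ) ^ 3 / K ≤ Finset.addEnergy A A →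
      ∃ A' ⊆ A, (A.card : ℝ) ≤ C * K ^ C * A'.card ∧ ((A' + A').card : ℝ) ≤ C * K ^ C * A'.card

end Literature.Combinatorics.Additive
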